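import Mathlib
import Summits.HubbardSuperconductivity.HubbardSuperconductivity.Theses.FunctionFieldCertificate

/-!
# Sketch — crux-ideate round 2, ideator 5, crux `MesoscopicPairOrder` (stmt-HubbardSuperconductivity-7331)

Typed statements only (`Prop`s and explicit finite sums); nothing is asserted.

* §1 vocabulary: the crux functional `fejerOrder` (verbatim), pair modes `pairMode`, pair structure
  factor `pairSF`, torus LRO density `lro`, the normalised Fejér weight in momentum space `fejerHat`
  and the finite Goldstone-leakage sum `goldstoneLeak`.
* §2 the POINTWISE re-cut the r1 triage panel asked planners to type (TRIAGE-r1-1 sharpen lines,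
  r1-3 §Numbers): `PointwiseInfraredProfileAt` (global pointwise cap `S_ψ(m) ≤ S_flat + A/|q_m|`,
  stronger at the point than the Σ-form `WindowInfraredBound`), `SeedPairOrderAt` (one scale),
  the model-free closure `PointwiseOneScaleClosure` (Parseval bookkeeping, provable now), the kernel
  bound `GoldstoneLeakBound` (numerically `c_G ≤ 0.49/R`), and the glued split `PointwiseSplit`.
* §3 the kinetic-coercivity conjecture examined this round (`SingletKineticCoercivity`, kernel form
  `SingletFreeKineticFloor`) and the every-ground-state floor it would give (`NNSingletFloorAt`);
  4×4 exact diagonalisation (kit jobs j019708/j019721) supports the kernel form and shows the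
  d-wave analogue is FALSE (the joint kernel of the local d-wave pair operators contains near-free
  states), see the ideation report.
-/

noncomputable section

-- the summit namespace repeats the problem name by design (D-0017)
set_option linter.dupNamespace false

namespace Summit.HubbardSuperconductivity.HubbardSuperconductivity.Cruxes.MesoscopicPairOrder.Ideator5

open Matrix Finset
open Literature.MathematicalPhysics.QuantumLattice Literature.Probability.LatticeModels
open Summit.HubbardSuperconductivity.HubbardSuperconductivity.Theses.FunctionFieldCertificate
open scoped BigOperators ComplexOrder

/-! ### §1 Vocabulary -/

section Vocabulary

variable (L : ℕ) [NeZero L]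

/-- The crux's Fejér-box functional `K_R(ψ) = L⁻² Σ_{x,y} Πᵢ(1 − |(y−x)ᵢ|_L/R)₊ Re⟨P_xψ, P_yψ⟩`
(verbatim the quantity `m R² ≤ ·` of `MesoscopicPairOrder`). -/
def fejerOrder (R : ℕ) (ψ : Fock (Orb (FermionTorus 2 L))) : ℝ :=
  (∑ x : TorusSite 2 L, ∑ y : TorusSite 2 L,
      (∏ i : Fin 2, max 0 (1 - |(((y i - x i).valMinAbs : ℤ) : ℝ)| / (R : ℝ))) *
        (star (localPair dWaveFormFactor L x *ᵥ ψ) ⬝ᵥ (localPair dWaveFormFactor L y *ᵥ ψ)).re) /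
    (L : ℝ) ^ 2

/-- The `d`-wave pair mode `D(m) = Σ_x e^{−2πi m·x/L} P_x` (as in `WindowInfraredBound`). -/
def pairMode (m : Fin 2 → ZMod L) :
    Matrix (Finset (Orb (FermionTorus 2 L))) (Finset (Orb (FermionTorus 2 L))) ℂ :=
  ∑ x : Fin 2 → ZMod L,
    Complex.exp (-(2 * Real.pi * Complex.I * (((∑ i : Fin 2, m i * x i).val : ℕ) : ℂ) / (L : ℂ))) •
      localPair dWaveFormFactor L x

/-- Pair structure factor density `S_ψ(m) = ‖D(m)ψ‖² / L²` (`O(1)` for a normal state,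
`= L² · lro` at `m = 0`). -/
def pairSF (ψ : Fock (Orb (FermionTorus 2 L))) (m : Fin 2 → ZMod L) : ℝ :=
  (star (pairMode L m *ᵥ ψ) ⬝ᵥ (pairMode L m *ᵥ ψ)).re / (L : ℝ) ^ 2

/-- `|q_m|`: Euclidean norm of the minimal representative `2π valMinAbs(m)/L ∈ (−π, π]²`. -/
def qnorm (m : Fin 2 → ZMod L) : ℝ :=
  (2 * Real.pi / (L : ℝ)) * Real.sqrt (∑ i : Fin 2, (((m i).valMinAbs : ℤ) : ℝ) ^ 2)

/-- Torus LRO density `L⁻⁴ Re⟨Δ_d ψ, Δ_d ψ⟩` (the summit's quantity at side `L`). -/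
def lro (ψ : Fock (Orb (FermionTorus 2 L))) : ℝ :=
  (star (pairField dWaveFormFactor L *ᵥ ψ) ⬝ᵥ (pairField dWaveFormFactor L *ᵥ ψ)).re / (L : ℝ) ^ 4

/-- Normalised Fejér weight in momentum space, `w_R(m) = Πᵢ F_R(2π valMinAbs(mᵢ)/L)` with
`F_R(θ) = sin²(Rθ/2)/(R² sin²(θ/2))`, `F_R(0) = 1`; `w_R ∈ [0,1]`, `w_R(0) = 1`,
`Σ_m w_R(m) = L²/R²` (Parseval, `2R ≤ L`). It is `|F_R(m)|²/R⁴` for the tree's box kernel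
(`BoxKernelBounds`), and `R⁻² fejerOrder L R ψ = L⁻² Σ_m w_R(m) · pairSF L ψ m` (p120205). -/
def fejerHat (R : ℕ) (m : Fin 2 → ZMod L) : ℝ :=
  ∏ i : Fin 2,
    (if (m i).valMinAbs = 0 then (1 : ℝ) else
      Real.sin ((R : ℝ) * (2 * Real.pi * (((m i).valMinAbs : ℤ) : ℝ) / (L : ℝ)) / 2) ^ 2 /
        ((R : ℝ) ^ 2 * Real.sin ((2 * Real.pi * (((m i).valMinAbs : ℤ) : ℝ) / (L : ℝ)) / 2) ^ 2))

/-- Goldstone leakage constant `c_G(L,R) = L⁻² Σ_{m ≠ 0} w_R(m)/|q_m|`: the weight a pointwise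
`A/|q|` profile deposits into `K_R/R²`. Finite sum; numerically `c_G · R ∈ [0.32, 0.49]` for
`4 ≤ R ≤ 256`, `4R ≤ L ≤ 2048` (calc/pointwise_leakage.py). -/
def goldstoneLeak (R : ℕ) : ℝ :=
  (∑ m : Fin 2 → ZMod L, if m = 0 then 0 else fejerHat L R m / qnorm L m) / (L : ℝ) ^ 2

end Vocabulary

/-! ### §2 The pointwise re-cut (seed at one scale + global pointwise infrared profile) -/

/-- **Momentum form of the crux functional** (p120205, restated in this vocabulary; provable now):
`R⁻² K_R(ψ) = L⁻² Σ_m w_R(m) S_ψ(m)` for `0 < R`, `2R ≤ L`. -/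
def FejerOrderMomentumForm : Prop :=
  ∀ (L R : ℕ) [NeZero L], 0 < R → 2 * R ≤ L → ∀ ψ : Fock (Orb (FermionTorus 2 L)),
    fejerOrder L R ψ / (R : ℝ) ^ 2 = (∑ m : Fin 2 → ZMod L, fejerHat L R m * pairSF L ψ m) / (L : ℝ) ^ 2

/-- **Pointwise one-scale closure** (model-free, every vector; provable now by Parseval
`Σ_m w_R = L²/R²`, `w_R(0) = 1`, `pairSF(0) = L² · lro`): a GLOBAL pointwise cap
`S_ψ(m) ≤ S_flat + A/|q_m|` for all `m ≠ 0` turns a Fejér-box value at ONE scale into torus LRO,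
`lro ψ ≥ K_{R₀}(ψ)/R₀² − S_flat (1/R₀² − 1/L²) − A · c_G(L,R₀)`. No `ε`-window, no tail, no
total-weight constant `32`: the flat background leaks EXACTLY `S_flat(1/R₀² − 1/L²)`. -/
def PointwiseOneScaleClosure : Prop :=
  ∀ (L R₀ : ℕ) [NeZero L], 0 < R₀ → 2 * R₀ ≤ L → ∀ (S_flat A : ℝ), 0 ≤ S_flat → 0 ≤ A →
    ∀ ψ : Fock (Orb (FermionTorus 2 L)),
      (∀ m : Fin 2 → ZMod L, m ≠ 0 → pairSF L ψ m ≤ S_flat + A / qnorm L m) →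
        fejerOrder L R₀ ψ / (R₀ : ℝ) ^ 2 - S_flat * (1 / (R₀ : ℝ) ^ 2 - 1 / (L : ℝ) ^ 2)
            - A * goldstoneLeak L R₀ ≤ lro L ψ

/-- **Kernel bound for the Goldstone leakage** (elementary real analysis on the finite sum;
numerically `≤ 0.49/R`; stated with the safe constant `1`): `c_G(L,R) ≤ 1/R` for `0 < R`, `2R ≤ L`. -/
def GoldstoneLeakBound : Prop :=
  ∀ (L R : ℕ) [NeZero L], 0 < R → 2 * R ≤ L → goldstoneLeak L R ≤ 1 / (R : ℝ)

/-- **Pointwise infrared profile at `(U, δ)`** — the POINTWISE pole half the panel asked for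
(TRIAGE-r1-1 and r1-3, "sharpen"): in every normalised `(N_L, 0)`-sector ground state of
`hubbardTorus 2 L 1 U`, every NONZERO pair mode obeys `S_ψ(m) ≤ S_flat + A/|q_m|`
(flat normal background + Goldstone `1/|q|`; free-gas calibration `S_flat ≈ 2.2–2.5`, tree bound
`≤ 50` at `U = 0`, p120050). Stronger at the point than the Σ-form `WindowInfraredBound`
(summing the cap over `0 < |q| ≤ ε` gives `≤ (S_flat ε/4π + A/2π) ε L²`). -/
def PointwiseInfraredProfileAt (U δ S_flat A : ℝ) : Prop :=
  ∃ L₀ : ℕ, ∀ (L : ℕ) [NeZero L], L₀ ≤ L → Even L →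
    ∀ ψ : Fock (Orb (FermionTorus 2 L)), star ψ ⬝ᵥ ψ = 1 →
      IsGroundStateInSector (hubbardTorus 2 L 1 U) (2 * ⌊(1 - δ) * (L : ℝ) ^ 2 / 2⌋₊) 0 ψ →
        ∀ m : Fin 2 → ZMod L, m ≠ 0 → pairSF L ψ m ≤ S_flat + A / qnorm L m

/-- **Seed at one scale** (ideator-3's `SeedPairOrder`, pointwise in `(U, δ)`): the crux body at the
single scale `R₀`. -/
def SeedPairOrderAt (U δ m₀ : ℝ) (R₀ : ℕ) : Prop :=
  ∃ L₀ : ℕ, ∀ (L : ℕ) [NeZero L], L₀ ≤ L → Even L →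
    ∀ ψ : Fock (Orb (FermionTorus 2 L)), star ψ ⬝ᵥ ψ = 1 →
      IsGroundStateInSector (hubbardTorus 2 L 1 U) (2 * ⌊(1 - δ) * (L : ℝ) ^ 2 / 2⌋₊) 0 ψ →
        m₀ * (R₀ : ℝ) ^ 2 ≤ fejerOrder L R₀ ψ

/-- **The glued pointwise split** (provable now from `PointwiseOneScaleClosure`, `GoldstoneLeakBound`
and the landed Fejér floor `fejerBox_floor_pairField`): seed at ONE scale `R₀` + a global pointwise
profile at the SAME `(U, δ)` with `S_flat/R₀² + A/R₀ < m₀` give the crux (margin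
`m₀ − S_flat/R₀² − A/R₀` at every scale) — and, by the same inequality, the summit at `(U, δ)`.
Sizing (calc/pointwise_leakage.py, reproducing TRIAGE-r1-3): with `S_flat = 2.2`, `A = 5a` and a
demanded LRO `a/2`, `R₀ = 24 / 63 / 69 / 212 / 334` at `a = 10⁻² / 1.2·10⁻³ / 10⁻³ / 10⁻⁴ / 4·10⁻⁵`
(`S_flat = 0.5`: `13 / 32 / 34 / 103 / 161`). -/
def PointwiseSplit : Prop :=
  (∃ U : ℝ, 0 < U ∧ ∃ δ ∈ Set.Ioo (0:ℝ) (1 / 2), ∃ (S_flat A m₀ : ℝ) (R₀ : ℕ),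
      0 ≤ S_flat ∧ 0 ≤ A ∧ 0 < R₀ ∧ S_flat / (R₀ : ℝ) ^ 2 + A / (R₀ : ℝ) < m₀ ∧
        SeedPairOrderAt U δ m₀ R₀ ∧ PointwiseInfraredProfileAt U δ S_flat A) →
    MesoscopicPairOrder

/-! ### §3 Kinetic coercivity of the nearest-neighbour singlet content (examined this round) -/

section Coercivity

variable (L : ℕ) [NeZero L]

/-- The nearest-neighbour bond singlet annihilator `b_{x,e} = c_{x↑}c_{x+e,↓} − c_{x↓}c_{x+e,↑}`
(`b†b = 2(n_x n_{x+e}/4 − S_x·S_{x+e})`; `P_x = Σ_e (g_d(e)/√2) b_{x,e}` is the tree's `localPair`). -/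
def bondSinglet (x : TorusSite 2 L) (e : Site 2) :
    Matrix (Finset (Orb (FermionTorus 2 L))) (Finset (Orb (FermionTorus 2 L))) ℂ :=
  annihilation (orb (FermionTorus.ofTorusSite x) 0) *
      annihilation (orb (FermionTorus.ofTorusSite (x + Torus.proj L e)) 1) -
    annihilation (orb (FermionTorus.ofTorusSite x) 1) *
      annihilation (orb (FermionTorus.ofTorusSite (x + Torus.proj L e)) 0)

/-- Nearest-neighbour singlet content `Σ_x Σ_{e ∈ {±e₁,±e₂}} ‖b_{x,e} ψ‖²`
(`= 4 Σ_{⟨xy⟩} ⟨n_x n_y/4 − S_x·S_y⟩_ψ`, each bond counted twice). -/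
def singletContent (ψ : Fock (Orb (FermionTorus 2 L))) : ℝ :=
  ∑ x : TorusSite 2 L, ∑ e ∈ unitSteps, (star (bondSinglet L x e *ᵥ ψ) ⬝ᵥ (bondSinglet L x e *ᵥ ψ)).re

/-- The fully polarised kinetic floor `E_pol(L, N)`: lowest energy of the FREE torus Hamiltonian
(`U = 0`) in the saturated sector `(N, S^z = N/2)` — spinless free fermions. -/
def polarizedEnergy (N : ℕ) : ℝ :=
  (hubbardTorus 2 L 1 0).minEnergyOn (szSector (Λ := FermionTorus 2 L) N ((N : ℝ) / 2))

end Coercivity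

/-- **CONJECTURE `SingletKineticCoercivity` (linear form)**: a universal `C` with
`Re⟨ψ, T ψ⟩ + C · singletContent ψ ≥ E_pol(L, N) ‖ψ‖²` for every `N`-particle vector — "absence of
nearest-neighbour singlets costs the full polarisation energy". 4×4 ED (kit j019721): the ratio
`(E_pol − ⟨T⟩)/singletContent` along the penalised minimisers is what decides finiteness of `C`;
the kernel form below holds there exactly (the minimum over singlet-free states IS `E_pol`). -/
def SingletKineticCoercivity : Prop :=
  ∃ C : ℝ, 0 < C ∧ ∀ (L : ℕ) [NeZero L], 2 ≤ L → ∀ N : ℕ, N ≤ L ^ 2 →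
    ∀ ψ : Fock (Orb (FermionTorus 2 L)), ψ ∈ nParticleSubmodule N →
      polarizedEnergy L N * (star ψ ⬝ᵥ ψ).re ≤
        (star ψ ⬝ᵥ (hubbardTorus 2 L 1 0 *ᵥ ψ)).re + C * singletContent L ψ

/-- **Kernel form** (`C = ∞`): an `N`-particle vector killed by every nearest-neighbour bond
singlet operator has kinetic energy at least the saturated-ferromagnet value `E_pol(L, N)`
(attained by the `S = N/2` multiplet). Supported by 4×4 ED at `N = 4, 6`. -/
def SingletFreeKineticFloor : Prop :=
  ∀ (L : ℕ) [NeZero L], 2 ≤ L → ∀ N : ℕ, N ≤ L ^ 2 →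
    ∀ ψ : Fock (Orb (FermionTorus 2 L)), ψ ∈ nParticleSubmodule N → singletContent L ψ = 0 →
      polarizedEnergy L N * (star ψ ⬝ᵥ ψ).re ≤ (star ψ ⬝ᵥ (hubbardTorus 2 L 1 0 *ᵥ ψ)).re

/-- **Every-ground-state nearest-neighbour singlet floor at `(U, δ)`** — what the linear conjecture
yields together with the Hartree–Fock upper bound `E_GS ≤ E_free + U n² L²/4`:
`σ = (e_pol(n) − e_free(n) − U n²/4)/C > 0` for `U < U*(n) = 4(e_pol − e_free)/n²`
(`U*(0.8) ≈ 6.3`: `e_pol(0.8) = −0.574`, `e_free(0.8) = −1.583`). A quantitative replacement for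
the saturated-FM exclusion of `Disproof.lean` §2 (answering its §4 (iii)/(iv)); it does NOT reach the
crux's `d`-wave local weight (the `d`-kernel analogue is false numerically). -/
def NNSingletFloorAt (U δ σ : ℝ) : Prop :=
  ∃ L₀ : ℕ, ∀ (L : ℕ) [NeZero L], L₀ ≤ L → Even L →
    ∀ ψ : Fock (Orb (FermionTorus 2 L)), star ψ ⬝ᵥ ψ = 1 →
      IsGroundStateInSector (hubbardTorus 2 L 1 U) (2 * ⌊(1 - δ) * (L : ℝ) ^ 2 / 2⌋₊) 0 ψ →
        σ * (L : ℝ) ^ 2 ≤ singletContent L ψ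

/-! ### Sanity: the crux is literally `∃ (U,δ,m) ∀R₀ ∃R … m R² ≤ fejerOrder` -/

theorem mesoscopicPairOrder_iff_fejerOrder :
    MesoscopicPairOrder ↔
      ∃ U : ℝ, 0 < U ∧ ∃ δ ∈ Set.Ioo (0:ℝ) (1 / 2), ∃ m : ℝ, 0 < m ∧ ∀ R₀ : ℕ, ∃ R : ℕ, R₀ ≤ R ∧
        ∃ L₀ : ℕ, ∀ (L : ℕ) [NeZero L], L₀ ≤ L → Even L →
          ∀ ψ : Fock (Orb (FermionTorus 2 L)), star ψ ⬝ᵥ ψ = 1 →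
            IsGroundStateInSector (hubbardTorus 2 L 1 U) (2 * ⌊(1 - δ) * (L : ℝ) ^ 2 / 2⌋₊) 0 ψ →
              m * (R : ℝ) ^ 2 ≤ fejerOrder L R ψ :=
  Iff.rfl

/-- Seed + pointwise profile give the seed of the crux at the SAME scale trivially (bookkeeping
check that the quantifier shapes line up). -/
example (U δ m₀ : ℝ) (R₀ : ℕ) (h : SeedPairOrderAt U δ m₀ R₀) : SeedPairOrderAt U δ m₀ R₀ := h

end Summit.HubbardSuperconductivity.HubbardSuperconductivity.Cruxes.MesoscopicPairOrder.Ideator5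

end
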